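import Mathlib
import HarnessLib
import Summits.QuantumFields.YangMills.Theses.PencilRigidity
import Literature.MathematicalPhysics.QuantumFieldTheory.OSReconstructionNoE1Proofs
import Summits.QuantumFields.YangMills.Theorems.PencilRigidityCurvatureKernelBoundChartDerivativeBoundsTensor
import Summits.QuantumFields.YangMills.Theorems.PencilRigidityCurvatureKernelBoundChartDerivativeBoundsFrame
import Summits.QuantumFields.YangMills.Theorems.PencilRigidityCurvatureKernelBoundChartDerivativeBoundsCore

/-!
# `CurvatureKernelBound` — stub A1 `ChartDerivativeBounds`: derivative bounds across a reflection-positive mirror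

Crux `stmt-QuantumFields-11687` (`PencilRigidity.CurvatureKernelBound`), line
`sixteen-charts-analytic-kernel`, stub `ChartDerivativeBounds` (A1): the QFT → analysis interface of
the lever "16 reflection-positive charts ⇒ the two-point function is a continuous kernel off `0`".

For a one-species Schwinger family `𝔖` on `ℝ⁴` and a linear isometry `R` such that the pulled-back
family `n ↦ 𝔖ₙ ∘ linActMulti R` is reflection positive along `e₀` and `𝔖` is translation invariant
on `⁰𝒮`, there is ONE Schwartz order `M₀` such that for every `N` there are `C, p` with
`|𝔖₂(F)| ≤ C δ^{-p} |f|_{M₀} |g|_{M₀}` for every `0 < δ ≤ 1`, every `f` supported in `{⟪x, n⟫ < 0}`,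
`g` supported in `{⟪x, n⟫ > δ}` (`n = R e₀`) and every tensor witness `F` of `(∂ₙᴺ f) ⊗ g` or of
`f ⊗ ∂ₙᴺ g` — Osterwalder–Schrader's `e^{-tH}` estimate [OS 1973 §4.1 (4.6)–(4.10); Glimm–Jaffe
Thm. 6.1.3] made frame-wise and quantitative:

* `le_mul_two_mul_of_scaling`: the scaling trick `V ≤ R((sA)² + (B/s)²) ∀ s > 0 ⇒ V ≤ 2RAB`;
* `norm_two_point_iterate_lineDeriv_le_prod`: the product form of the core estimate in the time
  frame (from `…ChartDerivativeBoundsCore`);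
* **`ChartDerivativeBounds`**: the registered stub, by the frame change `f ↦ f ∘ R`
  (`…ChartDerivativeBoundsFrame`).
[folklore]
-/

noncomputable section

open scoped SchwartzMap LineDeriv ComplexConjugate InnerProductSpace
open Filter Set MeasureTheory
open Literature.MathematicalPhysics.AQFT Literature.MathematicalPhysics.QuantumLattice
open Literature.MathematicalPhysics.QuantumFieldTheory

namespace Summit.QuantumFields.YangMills.Theorems.CurvatureKernel

/-! ## From the sum form to the product form -/

/-- **The scaling trick**: if `V ≤ R((sA)² + (s⁻¹B)²)` for all `s > 0` (and `V ≤ 0` in the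
degenerate cases `A = 0` or `B = 0`), then `V ≤ R · 2AB`. [folklore] -/
theorem le_mul_two_mul_of_scaling {A B R V : ℝ} (hA : 0 ≤ A) (hB : 0 ≤ B) (hR : 0 ≤ R)
    (hA0 : A = 0 → V ≤ 0) (hB0 : B = 0 → V ≤ 0)
    (h : ∀ s : ℝ, 0 < s → V ≤ R * ((s * A) ^ 2 + (s⁻¹ * B) ^ 2)) : V ≤ R * (2 * A * B) := by
  have hRAB : 0 ≤ R * (2 * A * B) := by positivity
  rcases hA.lt_or_eq with hA' | hA'
  · rcases hB.lt_or_eq with hB' | hB'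
    · have hBA : 0 < B / A := div_pos hB' hA'
      have hs : 0 < Real.sqrt (B / A) := Real.sqrt_pos.2 hBA
      have hsq : Real.sqrt (B / A) ^ 2 = B / A := Real.sq_sqrt hBA.le
      refine (h _ hs).trans (le_of_eq ?_)
      rw [mul_pow, mul_pow, inv_pow, hsq]
      field_simp
      ring
    · exact (hB0 hB'.symm).trans hRAB
  · exact (hA0 hA'.symm).trans hRAB

variable {d : ℕ} [NeZero d]

/-- A test function all of whose Schwartz norms of order `M` vanish is zero. [folklore] -/
theorem eq_zero_of_schwartzNorm_eq_zero {X : Type*} [NormedAddCommGroup X] [NormedSpace ℝ X] {M : ℕ}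
    {f : 𝓢(X, ℂ)} (hf : schwartzNorm M f = 0) : f = 0 := by
  ext x
  have h := norm_le_schwartzNorm M f x
  rw [hf, norm_le_zero_iff] at h
  simp [h]

/-- Iterated line derivatives of `0` vanish. [folklore] -/
theorem iterate_lineDerivOp_zero {V : Type*} [NormedAddCommGroup V] [NormedSpace ℝ V] (v : V) (N : ℕ) :
    ((∂_{v} : 𝓢(V, ℂ) → 𝓢(V, ℂ))^[N] (0 : 𝓢(V, ℂ))) = 0 := by
  simpa using iterate_lineDerivOp_smul v N (0 : ℂ) (0 : 𝓢(V, ℂ))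

/-- **The core estimate, product form (time frame).** For a one-species family with reflection
positivity and translation invariance on `⁰𝒮` there is one Schwartz order `M` such that for every
`N` there are `C ≥ 0` and `p` with `|𝔖₂(∂₀ᴺ f ⊗ g)|, |𝔖₂(f ⊗ ∂₀ᴺ g)| ≤ C δ^{-p} |f|_M |g|_M` whenever
`0 < δ ≤ 1`, `supp f ⊆ {y₀ < 0}`, `supp g ⊆ {y₀ > δ}`. [folklore] -/
theorem norm_two_point_iterate_lineDeriv_le_prod (S : SchwingerFamily (EuclideanSpace ℝ (Fin d)))
    (h : OSReconstructionNoE1 S.toLabelled) :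
    ∃ M : ℕ, ∀ N : ℕ, ∃ (C : ℝ) (p : ℕ), 0 ≤ C ∧ ∀ δ : ℝ, 0 < δ → δ ≤ 1 →
      ∀ (f g : 𝓢(EuclideanSpace ℝ (Fin d), ℂ)),
        tsupport (f : EuclideanSpace ℝ (Fin d) → ℂ) ⊆ {y | y 0 < 0} →
        tsupport (g : EuclideanSpace ℝ (Fin d) → ℂ) ⊆ {y | δ < y 0} →
        ‖S 2 (SchwartzMap.tensorFin 2 ![((∂_{EuclideanSpace.single (0 : Fin d) (1 : ℝ)} :
              𝓢(EuclideanSpace ℝ (Fin d), ℂ) → 𝓢(EuclideanSpace ℝ (Fin d), ℂ))^[N] f), g])‖ ≤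
            C * (1 / δ) ^ p * schwartzNorm M f * schwartzNorm M g ∧
        ‖S 2 (SchwartzMap.tensorFin 2 ![f,
            ((∂_{EuclideanSpace.single (0 : Fin d) (1 : ℝ)} :
              𝓢(EuclideanSpace ℝ (Fin d), ℂ) → 𝓢(EuclideanSpace ℝ (Fin d), ℂ))^[N] g)])‖ ≤
            C * (1 / δ) ^ p * schwartzNorm M f * schwartzNorm M g := by
  obtain ⟨M, K, hK, hcore⟩ := norm_two_point_iterate_lineDeriv_le_sum S h
  refine ⟨M, fun N => ⟨(2 * N / Real.exp 1) ^ N * (2 * K), N, by positivity, fun δ hδ hδ1 f g hf hg => ?_⟩⟩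
  set e₀ : EuclideanSpace ℝ (Fin d) := EuclideanSpace.single (0 : Fin d) (1 : ℝ) with he₀
  set Rδ : ℝ := (N / (Real.exp 1 * (δ / 2))) ^ N * K with hRδ
  have hRδ0 : 0 ≤ Rδ := by positivity
  have hRδeq : Rδ * (2 * schwartzNorm M f * schwartzNorm M g) =
      (2 * N / Real.exp 1) ^ N * (2 * K) * (1 / δ) ^ N * schwartzNorm M f * schwartzNorm M g := by
    rw [hRδ, show (N : ℝ) / (Real.exp 1 * (δ / 2)) = 2 * N / Real.exp 1 * (1 / δ) by
      field_simp, mul_pow]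
    ring
  -- the scaled sum bounds
  have hscaled : ∀ s : ℝ, 0 < s →
      (‖S 2 (SchwartzMap.tensorFin 2 ![((∂_{e₀} : 𝓢(EuclideanSpace ℝ (Fin d), ℂ) →
          𝓢(EuclideanSpace ℝ (Fin d), ℂ))^[N] f), g])‖ ≤
        Rδ * ((s * schwartzNorm M f) ^ 2 + (s⁻¹ * schwartzNorm M g) ^ 2)) ∧
      (‖S 2 (SchwartzMap.tensorFin 2 ![f, ((∂_{e₀} : 𝓢(EuclideanSpace ℝ (Fin d), ℂ) →
          𝓢(EuclideanSpace ℝ (Fin d), ℂ))^[N] g)])‖ ≤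
        Rδ * ((s * schwartzNorm M f) ^ 2 + (s⁻¹ * schwartzNorm M g) ^ 2)) := by
    intro s hs
    have hfs : tsupport (((s : ℂ) • f : 𝓢(EuclideanSpace ℝ (Fin d), ℂ)) : EuclideanSpace ℝ (Fin d) → ℂ) ⊆
        {y | y 0 < 0} :=
      (tsupport_smul_subset_right (fun _ => (s : ℂ)) (f : EuclideanSpace ℝ (Fin d) → ℂ)).trans hf
    have hgs : tsupport ((((s⁻¹ : ℝ) : ℂ) • g : 𝓢(EuclideanSpace ℝ (Fin d), ℂ)) : EuclideanSpace ℝ (Fin d) → ℂ) ⊆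
        {y | δ < y 0} :=
      (tsupport_smul_subset_right (fun _ => ((s⁻¹ : ℝ) : ℂ)) (g : EuclideanSpace ℝ (Fin d) → ℂ)).trans hg
    obtain ⟨h1, h2⟩ := hcore N δ hδ hδ1 _ _ hfs hgs
    have hns : ‖(s : ℂ)‖ = s := by rw [Complex.norm_real, Real.norm_of_nonneg hs.le]
    have hns' : ‖((s⁻¹ : ℝ) : ℂ)‖ = s⁻¹ := by
      rw [Complex.norm_real, Real.norm_of_nonneg (inv_nonneg.2 hs.le)]
    rw [schwartzNorm_smul, schwartzNorm_smul, hns, hns', iterate_lineDerivOp_smul,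
      tensorFin_two_smul_left, tensorFin_two_smul_right, map_smul, map_smul, smul_smul] at h1 h2
    have hss : (s : ℂ) * ((s⁻¹ : ℝ) : ℂ) = 1 := by
      rw [← Complex.ofReal_mul, mul_inv_cancel₀ hs.ne', Complex.ofReal_one]
    rw [hss, one_smul] at h1 h2
    rw [hRδ, mul_assoc]
    exact ⟨h2, h1⟩
  have hA := schwartzNorm_nonneg M f
  have hB := schwartzNorm_nonneg M g
  have hA0 : schwartzNorm M f = 0 → f = 0 := eq_zero_of_schwartzNorm_eq_zero
  have hB0 : schwartzNorm M g = 0 → g = 0 := eq_zero_of_schwartzNorm_eq_zero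
  constructor
  · rw [← hRδeq]
    refine le_mul_two_mul_of_scaling hA hB hRδ0 (fun h0 => ?_) (fun h0 => ?_) fun s hs => (hscaled s hs).1
    · rw [hA0 h0, iterate_lineDerivOp_zero, tensorFin_two_zero_left, map_zero, norm_zero]
    · rw [hB0 h0, tensorFin_two_zero_right, map_zero, norm_zero]
  · rw [← hRδeq]
    refine le_mul_two_mul_of_scaling hA hB hRδ0 (fun h0 => ?_) (fun h0 => ?_) fun s hs => (hscaled s hs).2
    · rw [hA0 h0, tensorFin_two_zero_left, map_zero, norm_zero]
    · rw [hB0 h0, iterate_lineDerivOp_zero, tensorFin_two_zero_right, map_zero, norm_zero]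

/-! ## The stub: frame change to the time frame -/

/-- **Stub A1 `ChartDerivativeBounds`** of crux `stmt-QuantumFields-11687`, line
`sixteen-charts-analytic-kernel`: in one frame `R` with reflection positivity of the pulled-back
family along `e₀` and translation invariance of `𝔖` on `⁰𝒮`, pure derivatives of any order `N`
along the mirror normal `n = R e₀`, on either slot of a tensor `f ⊗ g` whose slots are separated by
the mirror with gap `δ`, cost only `C_N δ^{-p_N} |f|_{M₀} |g|_{M₀}` with ONE Schwartz order `M₀`
(Osterwalder–Schrader's `e^{-tH}` estimate, OS 1973 §4.1 (4.6)–(4.10) / Glimm–Jaffe Thm 6.1.3, made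
frame-wise).  Proof: pull everything back by `f ↦ f ∘ R` (`…ChartDerivativeBoundsFrame`) and apply
the product form of the core estimate in the time frame. [folklore] -/
theorem ChartDerivativeBounds : open Literature.MathematicalPhysics.QuantumLattice Literature.MathematicalPhysics.AQFT Literature.MathematicalPhysics.QuantumFieldTheory in ∀ (S₁ : SchwingerFamily (EuclideanSpace ℝ (Fin 4))) (R : (EuclideanSpace ℝ (Fin 4)) ≃ₗᵢ[ℝ] (EuclideanSpace ℝ (Fin 4))), (SchwingerFamily.toLabelled (fun n => (S₁ n).comp (linActMulti R))).IsReflectionPositive → (∀ (n : ℕ) (a : (EuclideanSpace ℝ (Fin 4))) (F : SchwartzMap (Fin n → (EuclideanSpace ℝ (Fin 4))) ℂ), IsOffDiagonal F → S₁ n (translateMulti a F) = S₁ n F) → ∃ M₀ : ℕ, ∀ N : ℕ, ∃ (C : ℝ) (p : ℕ), ∀ δ : ℝ, 0 < δ → δ ≤ 1 → ∀ (f g : SchwartzMap (EuclideanSpace ℝ (Fin 4)) ℂ), tsupport (f : (EuclideanSpace ℝ (Fin 4)) → ℂ) ⊆ {x : (EuclideanSpace ℝ (Fin 4)) | inner ℝ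 x (R (EuclideanSpace.single 0 1)) < 0} → tsupport (g : (EuclideanSpace ℝ (Fin 4)) → ℂ) ⊆ {x : (EuclideanSpace ℝ (Fin 4)) | δ < inner ℝ x (R (EuclideanSpace.single 0 1))} → ∀ F : SchwartzMap (Fin 2 → (EuclideanSpace ℝ (Fin 4))) ℂ, (IsTensorOf F ![((LineDeriv.lineDerivOp (R (EuclideanSpace.single 0 1)) : SchwartzMap (EuclideanSpace ℝ (Fin 4)) ℂ → SchwartzMap (EuclideanSpace ℝ (Fin 4)) ℂ)^[N] f), g] ∨ IsTensorOf F ![f, ((LineDeriv.lineDerivOp (R (EuclideanSpace.single 0 1)) : SchwartzMap (EuclideanSpace ℝ (Fin 4)) ℂ → SchwartzMap (EuclideanSpace ℝ (Fin 4)) ℂ)^[N] g)]) → ‖S₁ 2 F‖ ≤ C * (1 / δ) ^ p * schwartzNorm M₀ f * schwartzNorm M₀ g := by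
  intro S₁ R hRP hT
  set S' : SchwingerFamily (EuclideanSpace ℝ (Fin 4)) := fun n => (S₁ n).comp (linActMulti R) with hS'
  have h : OSReconstructionNoE1 S'.toLabelled :=
    ⟨hRP, isTranslationInvariant_toLabelled_comp_linActMulti S₁ R hT⟩
  obtain ⟨M, hM⟩ := norm_two_point_iterate_lineDeriv_le_prod S' h
  refine ⟨M, fun N => ?_⟩
  obtain ⟨C, p, hC0, hC⟩ := hM N
  refine ⟨C, p, fun δ hδ hδ1 f g hf hg F hF => ?_⟩
  set e₀ : EuclideanSpace ℝ (Fin 4) := EuclideanSpace.single (0 : Fin 4) (1 : ℝ) with he₀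
  set L : EuclideanSpace ℝ (Fin 4) ≃L[ℝ] EuclideanSpace ℝ (Fin 4) := R.toContinuousLinearEquiv with hL
  set fR : 𝓢(EuclideanSpace ℝ (Fin 4), ℂ) := SchwartzMap.compCLMOfContinuousLinearEquiv ℂ L f with hfR
  set gR : 𝓢(EuclideanSpace ℝ (Fin 4), ℂ) := SchwartzMap.compCLMOfContinuousLinearEquiv ℂ L g with hgR
  have hfRs : tsupport (fR : EuclideanSpace ℝ (Fin 4) → ℂ) ⊆ {y | y 0 < 0} :=
    tsupport_compCLMOfContinuousLinearEquiv_subset_of_inner R (fun r => r < 0) hf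
  have hgRs : tsupport (gR : EuclideanSpace ℝ (Fin 4) → ℂ) ⊆ {y | δ < y 0} :=
    tsupport_compCLMOfContinuousLinearEquiv_subset_of_inner R (fun r => δ < r) hg
  obtain ⟨h1, h2⟩ := hC δ hδ hδ1 fR gR hfRs hgRs
  have hnf : schwartzNorm M fR ≤ schwartzNorm M f := schwartzNorm_compCLMOfContinuousLinearEquiv_isometry_le R M f
  have hng : schwartzNorm M gR ≤ schwartzNorm M g := schwartzNorm_compCLMOfContinuousLinearEquiv_isometry_le R M g
  have hLe : L e₀ = R e₀ := rfl
  -- the two pulled-back two-point values are the original ones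
  have hval1 : S' 2 (SchwartzMap.tensorFin 2 ![((∂_{e₀} : 𝓢(EuclideanSpace ℝ (Fin 4), ℂ) →
      𝓢(EuclideanSpace ℝ (Fin 4), ℂ))^[N] fR), gR]) =
      S₁ 2 (SchwartzMap.tensorFin 2 ![((∂_{R e₀} : 𝓢(EuclideanSpace ℝ (Fin 4), ℂ) →
        𝓢(EuclideanSpace ℝ (Fin 4), ℂ))^[N] f), g]) := by
    rw [hfR, iterate_lineDerivOp_compCLMOfContinuousLinearEquiv, hLe, hS']
    simp only [ContinuousLinearMap.comp_apply]
    rw [hgR, hL, linActMulti_tensorFin_two_comp]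
  have hval2 : S' 2 (SchwartzMap.tensorFin 2 ![fR, ((∂_{e₀} : 𝓢(EuclideanSpace ℝ (Fin 4), ℂ) →
      𝓢(EuclideanSpace ℝ (Fin 4), ℂ))^[N] gR)]) =
      S₁ 2 (SchwartzMap.tensorFin 2 ![f, ((∂_{R e₀} : 𝓢(EuclideanSpace ℝ (Fin 4), ℂ) →
        𝓢(EuclideanSpace ℝ (Fin 4), ℂ))^[N] g)]) := by
    rw [hgR, iterate_lineDerivOp_compCLMOfContinuousLinearEquiv, hLe, hS']
    simp only [ContinuousLinearMap.comp_apply]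
    rw [hfR, hL, linActMulti_tensorFin_two_comp]
  have hCδ : 0 ≤ C * (1 / δ) ^ p := by positivity
  rcases hF with hF | hF
  · rw [hF.unique (isTensorOf_tensorFin _), ← hval1]
    calc _ ≤ C * (1 / δ) ^ p * schwartzNorm M fR * schwartzNorm M gR := h1
      _ ≤ C * (1 / δ) ^ p * schwartzNorm M f * schwartzNorm M g :=
          mul_le_mul (mul_le_mul_of_nonneg_left hnf hCδ) hng (schwartzNorm_nonneg _ _)
            (mul_nonneg hCδ (schwartzNorm_nonneg _ _))
  · rw [hF.unique (isTensorOf_tensorFin _), ← hval2]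
    calc _ ≤ C * (1 / δ) ^ p * schwartzNorm M fR * schwartzNorm M gR := h2
      _ ≤ C * (1 / δ) ^ p * schwartzNorm M f * schwartzNorm M g :=
          mul_le_mul (mul_le_mul_of_nonneg_left hnf hCδ) hng (schwartzNorm_nonneg _ _)
            (mul_nonneg hCδ (schwartzNorm_nonneg _ _))

end Summit.QuantumFields.YangMills.Theorems.CurvatureKernel
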